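/-
Copyright (c) 2026 the pub-hodgecm-mathlib formalisation cell (harness21).  Prover seat hodgecm-mathlib-K2E3-p03 (g3), Track B «K2-LIT» ∕ h413, road (d-w) of ‹J3› v2, letter
(C-ratio) brick (C1) «structure of the integral level of ramified `U(1,1)`»: the CORNER–DETERMINANT identity and the torus × special-unitary factorisation of `U(σ, antidiag(1,1))`.  2026-09-04.
-/
import Literature.NumberTheory.Automorphic.UnitaryGroupAutomorphicRep    -- ★ `unitaryGroupOfForm`, `mem_unitaryGroupOfForm_iff`
import Mathlib.Topology.Algebra.Valued.ValuationTopology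
import HarnessLib

/-!
# `U(σ, antidiag(1,1))` in two variables: `det g · σ(g₀₀) = g₀₀`, the corner factorisation `g = diag(a, σa⁻¹)·s`, `SU = {fixed diagonal, skew off-diagonal}`, and the integral
# level as `T(𝒪)·SU(𝒪) ∪ Φ₂·T(𝒪)·SU(𝒪)` (Rogawski 1990 §1.9–§1.10; Tits 1979 §3.9; Platonov–Rapinchuk 1994 §2.3)

Topic `NumberTheory/Automorphic`; namespace `Literature.NumberTheory.Automorphic.UnitaryGroup`.  THEOREMS ONLY (no definition, no instance, no notation, no named fact, no `sorry`);
kernel lane `--supports stmt-HodgeConjecture-24833`.  Cell `pub/hodgecm-mathlib`, Track B «K2-LIT», crux H413; road (d-w) of ‹J3› v2 (owner K2E3-p03 (g3)), letter (C-ratio) (cand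
`K2/K2E3-p03/g3/sig_K2E3WildPlaneCountRatio.cand.v1…`), brick **(C1) «`N_iso`»** of `K2/K2E3-p03/g3/TARGETS-Cratio.K2E3-p03-g3.md`: the closed forms `N_iso = [K⁰ : K⁰(4)] =
(q−1)(q+1)q^{8m−2}` (√u) ∕ `2(q−1)q^{8m−1}` (√π) rest on the STRUCTURE of `K⁰ = U(Φ₂)(L⁺_v) ∩ GL₂(𝒪_w)` proved here in field-generic form:
`K⁰ = T(𝒪_w)·SU(𝒪)` when an anti-fixed UNIT exists (√u), `K⁰ = T(𝒪_w)·SU(𝒪) ∪ Φ₂·T(𝒪_w)·SU(𝒪)` always, with `SU(Φ₂) = {s : det s = 1, s₀₀, s₁₁ σ-fixed, s₀₁, s₁₀ σ-skew}`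
`= diag(1,α)·SL₂(K^σ)·diag(1,α)⁻¹`.  Everything over a FIELD `K` with a ring endomorphism `σ` (an involution where stated); the CM one-place model `U(σ_w, (Φ₂)_w)(L_w)` is an instance
(★ `coe_mem_unitaryGroupOfForm_antidiag_two_of_mem_placeForm`).

* §1 ENTRY RELATIONS of `ᵗ(σg)·Φ₂·g = Φ₂` (`Φ₂ = !![0,1;1,0]`), and the CORNER–DETERMINANT identities **`det g · σ(g₀₀) = g₀₀`**, **`det g · σ(g₁₀) = −g₁₀`** (so `det g = g₀₀ ∕ σ(g₀₀)`
  whenever `g₀₀ ≠ 0`: the determinant class of `g` in `E¹ ∕ {e∕σe}` is read off ANY non-zero entry).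
* §2 `Φ₂ ∈ U`, `det Φ₂ = −1`; right translation by `Φ₂` swaps the columns.
* §3 **`SU(Φ₂)`**: for `det s = 1`, `s ∈ U ↔ σ s₀₀ = s₀₀ ∧ σ s₁₁ = s₁₁ ∧ σ s₀₁ = −s₀₁ ∧ σ s₁₀ = −s₁₀` (⇒: §1 applied to `s` and `s·Φ₂`; ⇐: the four relations by hand).
* §4 THE TORUS `t(e) = diag(e, (σe)⁻¹) ∈ U` (`σ` an involution) and the CORNER FACTORISATION: `g ∈ U`, `g₀₀ ≠ 0` ⇒ `g = t(g₀₀)·s` with `s ∈ U`, `det s = 1`,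
  `s = !![1, g₀₁∕g₀₀; σ(g₀₀)·g₁₀, σ(g₀₀)·g₁₁]`.
* §5 VALUED `K` (`|σx| = |x|`): `|det g| = 1`; an INTEGRAL `g ∈ U` (all `|gᵢⱼ| ≤ 1`) has `|g₀₀| = 1` or `|g₁₀| = 1`; in the first case `g = t·s` with `t`, `s` INTEGRAL (§4), in the second
  `g = Φ₂·t·s` likewise (§2+§4); and if an anti-fixed UNIT `α` exists (`σα = −α`, `|α| = 1`) then `Φ₂ = t(α)·s_α` with `s_α = !![0, α⁻¹; −α, 0] ∈ SU` integral — so at a √u place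
  EVERY integral `g` is `t·s`, while at a √π place the second class `Φ₂·T(𝒪)·SU(𝒪)` is genuinely new (`det = −1 = α∕σα` with `α` a uniformiser is not `e∕σe` for a unit `e`).
HONEST LABEL: count-neutral field algebra; HC_CM is proved only modulo the 7 printed citations (2 remaining named inputs: hLiu418 = stmt-HodgeConjecture-24832, h413 =
stmt-HodgeConjecture-24833) until rung 0 closes; the COUNTS of (C1) are NOT in this file.

## References
* [Rogawski1990] J. D. Rogawski, *Automorphic Representations of Unitary Groups in Three Variables*, Ann. of Math. Stud. 123 (1990), §1.9–§1.10 pp. 8–9 (`U(1,1)`, `SU(1,1) ≅ SL₂`).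
* [Tits1979] J. Tits, *Reductive groups over local fields*, PSPM 33.1 (1979), §3.9 (ramified `U(1,1)`: the two maximal compacts).
* [PlatonovRapinchuk1994] V. Platonov, A. Rapinchuk, *Algebraic Groups and Number Theory* (1994), §2.3 (unitary groups of hermitian forms), §3.3.
* [Jacobowitz1962] R. Jacobowitz, *Hermitian forms over local fields*, Amer. J. Math. 84 (1962), §5 (the ramified dyadic types `F(√u)`, `F(√π)`).
-/

set_option autoImplicit false

open scoped Matrix MatrixGroups
open Matrix WithZero

namespace Literature.NumberTheory.Automorphic

namespace UnitaryGroup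

/-! ## §1 Entry relations and the corner–determinant identity -/

section Relations

variable {K : Type*} [Field K] (σ : K →+* K)

/-- **The four entry relations** of `ᵗ(σg)·!![0,1;1,0]·g = !![0,1;1,0]` for `g = (a b; c d)`: `σa·c + σc·a = 0`, `σa·d + σc·b = 1`, `σb·c + σd·a = 1`, `σb·d + σd·b = 0`.
[cite: Rogawski1990, §1.9 p. 8] -/
theorem antidiagTwo_entry_relations {g : GL (Fin 2) K} (hg : g ∈ unitaryGroupOfForm σ !![(0 : K), 1; 1, 0]) :
    σ (g 0 0) * g 1 0 + σ (g 1 0) * g 0 0 = 0 ∧ σ (g 0 0) * g 1 1 + σ (g 1 0) * g 0 1 = 1 ∧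
      σ (g 0 1) * g 1 0 + σ (g 1 1) * g 0 0 = 1 ∧ σ (g 0 1) * g 1 1 + σ (g 1 1) * g 0 1 = 0 := by
  rw [mem_unitaryGroupOfForm_iff] at hg
  have h00 := congrFun (congrFun hg 0) 0
  have h01 := congrFun (congrFun hg 0) 1
  have h10 := congrFun (congrFun hg 1) 0
  have h11 := congrFun (congrFun hg 1) 1
  simp only [Matrix.mul_apply, Matrix.transpose_apply, Matrix.map_apply, Fin.sum_univ_two, Matrix.of_apply, Matrix.cons_val', Matrix.cons_val_zero,
    Matrix.cons_val_one, Matrix.empty_val', Matrix.cons_val_fin_one, Fin.isValue] at h00 h01 h10 h11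
  refine ⟨?_, ?_, ?_, ?_⟩
  · linear_combination h00
  · linear_combination h01
  · linear_combination h10
  · linear_combination h11

/-- **THE CORNER–DETERMINANT IDENTITY `det g · σ(g₀₀) = g₀₀`** on `U(σ, antidiag(1,1))`: `det·σa = adσa − bcσa = adσa + b·σc·a = a·(σa·d + σc·b) = a`.
[cite: Rogawski1990, §1.9 p. 8] -/
theorem det_mul_map_apply_zero_zero {g : GL (Fin 2) K} (hg : g ∈ unitaryGroupOfForm σ !![(0 : K), 1; 1, 0]) :
    (g : Matrix (Fin 2) (Fin 2) K).det * σ (g 0 0) = g 0 0 := by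
  obtain ⟨h1, h2, -, -⟩ := antidiagTwo_entry_relations σ hg
  rw [Matrix.det_fin_two]
  linear_combination (g 0 0 : K) * h2 - (g 0 1 : K) * h1

/-- **`det g · σ(g₁₀) = −g₁₀`** on `U(σ, antidiag(1,1))` (the same identity at the other entry of the first column). [cite: Rogawski1990, §1.9 p. 8] -/
theorem det_mul_map_apply_one_zero {g : GL (Fin 2) K} (hg : g ∈ unitaryGroupOfForm σ !![(0 : K), 1; 1, 0]) :
    (g : Matrix (Fin 2) (Fin 2) K).det * σ (g 1 0) = -(g 1 0 : K) := by
  obtain ⟨h1, h2, -, -⟩ := antidiagTwo_entry_relations σ hg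
  rw [Matrix.det_fin_two]
  linear_combination (g 1 1 : K) * h1 - (g 1 0 : K) * h2

/-- **`det g = g₀₀ ∕ σ(g₀₀)` whenever `g₀₀ ≠ 0`**: the determinant of a unitary matrix for `antidiag(1,1)` is the `σ`-quotient of its corner. [cite: Rogawski1990, §1.9 p. 8] -/
theorem det_eq_apply_zero_zero_div {g : GL (Fin 2) K} (hg : g ∈ unitaryGroupOfForm σ !![(0 : K), 1; 1, 0]) (h : (g 0 0 : K) ≠ 0) :
    (g : Matrix (Fin 2) (Fin 2) K).det = g 0 0 / σ (g 0 0) := by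
  have hσ : σ (g 0 0) ≠ 0 := (map_ne_zero σ).2 h
  rw [eq_div_iff hσ]
  exact det_mul_map_apply_zero_zero σ hg

/-- **`det g · σ(det g) = 1`** on `U(σ, antidiag(1,1))` (the determinant is a `σ`-norm-one element). [cite: Rogawski1990, §1.9 p. 8] -/
theorem det_mul_map_det_eq_one {g : GL (Fin 2) K} (hg : g ∈ unitaryGroupOfForm σ !![(0 : K), 1; 1, 0]) :
    (g : Matrix (Fin 2) (Fin 2) K).det * σ (g : Matrix (Fin 2) (Fin 2) K).det = 1 := by
  have h := congrArg Matrix.det (mem_unitaryGroupOfForm_iff.1 hg)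
  have hmap : (((g : Matrix (Fin 2) (Fin 2) K).map σ)ᵀ).det = σ (g : Matrix (Fin 2) (Fin 2) K).det := by
    rw [Matrix.det_transpose]
    exact ((RingHom.map_det σ (g : Matrix (Fin 2) (Fin 2) K)).trans (by rw [RingHom.mapMatrix_apply])).symm
  have hΦ : (!![(0 : K), 1; 1, 0]).det = -1 := by rw [Matrix.det_fin_two_of]; ring
  rw [Matrix.det_mul, Matrix.det_mul, hmap, hΦ] at h
  linear_combination -h

end Relations

/-! ## §2 The swap `Φ₂` -/

section Swap

variable {K : Type*} [Field K] (σ : K →+* K)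

/-- **`Φ₂ = antidiag(1,1)` is unitary for itself** (`σ` fixes `0` and `1`) and has determinant `−1`. [cite: Rogawski1990, §1.9 p. 8] -/
theorem mem_unitaryGroupOfForm_antidiagTwo_of_coe_eq {w₀ : GL (Fin 2) K} (hw₀ : (w₀ : Matrix (Fin 2) (Fin 2) K) = !![(0 : K), 1; 1, 0]) :
    w₀ ∈ unitaryGroupOfForm σ !![(0 : K), 1; 1, 0] ∧ (w₀ : Matrix (Fin 2) (Fin 2) K).det = -1 := by
  refine ⟨?_, by rw [hw₀, Matrix.det_fin_two_of]; ring⟩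
  rw [mem_unitaryGroupOfForm_iff, hw₀]
  ext i j
  fin_cases i <;> fin_cases j <;> simp [Matrix.mul_apply, Fin.sum_univ_two, Matrix.transpose_apply, Matrix.map_apply]

/-- Right translation by the Weyl element `Φ₂` swaps the columns: `(g·Φ₂)₀₀ = g₀₁`, `(g·Φ₂)₁₀ = g₁₁`, `(g·Φ₂)₀₁ = g₀₀`, `(g·Φ₂)₁₁ = g₁₀`. [cite: PlatonovRapinchuk1994, §2.3] -/
theorem mul_antidiagTwo_apply (g : Matrix (Fin 2) (Fin 2) K) :
    (g * !![(0 : K), 1; 1, 0]) 0 0 = g 0 1 ∧ (g * !![(0 : K), 1; 1, 0]) 1 0 = g 1 1 ∧ (g * !![(0 : K), 1; 1, 0]) 0 1 = g 0 0 ∧ (g * !![(0 : K), 1; 1, 0]) 1 1 = g 1 0 := by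
  refine ⟨?_, ?_, ?_, ?_⟩ <;> simp [Matrix.mul_apply, Fin.sum_univ_two]

/-- Left translation by the Weyl element `Φ₂` swaps the rows: `(Φ₂·g)₀₀ = g₁₀`, `(Φ₂·g)₁₀ = g₀₀`, `(Φ₂·g)₀₁ = g₁₁`, `(Φ₂·g)₁₁ = g₀₁`. [cite: PlatonovRapinchuk1994, §2.3] -/
theorem antidiagTwo_mul_apply (g : Matrix (Fin 2) (Fin 2) K) :
    (!![(0 : K), 1; 1, 0] * g) 0 0 = g 1 0 ∧ (!![(0 : K), 1; 1, 0] * g) 1 0 = g 0 0 ∧ (!![(0 : K), 1; 1, 0] * g) 0 1 = g 1 1 ∧ (!![(0 : K), 1; 1, 0] * g) 1 1 = g 0 1 := by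
  refine ⟨?_, ?_, ?_, ?_⟩ <;> simp [Matrix.mul_apply, Fin.sum_univ_two]

end Swap

/-! ## §3 The special unitary group: fixed diagonal, skew off-diagonal -/

section Special

variable {K : Type*} [Field K] (σ : K →+* K)

/-- **`SU(σ, antidiag(1,1))` BY ENTRIES (⇒)**: if `g ∈ U` has `det g = 1` then `σ g₀₀ = g₀₀`, `σ g₁₁ = g₁₁`, `σ g₀₁ = −g₀₁`, `σ g₁₀ = −g₁₀` — §1's identities for `g` and for `g·Φ₂`
(`SU(1,1) = diag(1,α)·SL₂(K^σ)·diag(1,α)⁻¹` for any anti-fixed `α`). [cite: Rogawski1990, §1.9–§1.10 pp. 8–9] -/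
theorem map_apply_of_mem_unitaryGroupOfForm_antidiagTwo_of_det_eq_one {g : GL (Fin 2) K} (hg : g ∈ unitaryGroupOfForm σ !![(0 : K), 1; 1, 0])
    (hdet : (g : Matrix (Fin 2) (Fin 2) K).det = 1) :
    σ (g 0 0) = g 0 0 ∧ σ (g 1 1) = g 1 1 ∧ σ (g 0 1) = -(g 0 1 : K) ∧ σ (g 1 0) = -(g 1 0 : K) := by
  have h00 := det_mul_map_apply_zero_zero σ hg
  have h10 := det_mul_map_apply_one_zero σ hg
  rw [hdet, one_mul] at h00 h10
  -- the swapped element `g·Φ₂`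
  obtain ⟨w₀, hw₀⟩ : ∃ w₀ : GL (Fin 2) K, (w₀ : Matrix (Fin 2) (Fin 2) K) = !![(0 : K), 1; 1, 0] :=
    ⟨Matrix.GeneralLinearGroup.mkOfDetNeZero !![(0 : K), 1; 1, 0] (by rw [Matrix.det_fin_two_of]; norm_num), rfl⟩
  obtain ⟨hw₀U, hw₀det⟩ := mem_unitaryGroupOfForm_antidiagTwo_of_coe_eq σ hw₀
  have hg' : g * w₀ ∈ unitaryGroupOfForm σ !![(0 : K), 1; 1, 0] := Subgroup.mul_mem _ hg hw₀U
  have h00' := det_mul_map_apply_zero_zero σ hg'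
  have h10' := det_mul_map_apply_one_zero σ hg'
  obtain ⟨e00, e10, -, -⟩ := mul_antidiagTwo_apply (g : Matrix (Fin 2) (Fin 2) K)
  have hcoe : ((g * w₀ : GL (Fin 2) K) : Matrix (Fin 2) (Fin 2) K) = (g : Matrix (Fin 2) (Fin 2) K) * !![(0 : K), 1; 1, 0] := by rw [Units.val_mul, hw₀]
  have hΦdet : (!![(0 : K), 1; 1, 0] : Matrix (Fin 2) (Fin 2) K).det = -1 := by rw [Matrix.det_fin_two_of]; ring
  have hdet' : ((g * w₀ : GL (Fin 2) K) : Matrix (Fin 2) (Fin 2) K).det = -1 := by rw [hcoe, Matrix.det_mul, hdet, hΦdet, one_mul]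
  have a00 : ((g * w₀ : GL (Fin 2) K) : Matrix (Fin 2) (Fin 2) K) 0 0 = g 0 1 := by rw [hcoe]; exact e00
  have a10 : ((g * w₀ : GL (Fin 2) K) : Matrix (Fin 2) (Fin 2) K) 1 0 = g 1 1 := by rw [hcoe]; exact e10
  rw [hdet', a00] at h00'
  rw [hdet', a10] at h10'
  refine ⟨h00, ?_, ?_, h10.symm ▸ by ring⟩
  · linear_combination -h10'
  · linear_combination -h00'

/-- **`SU(σ, antidiag(1,1))` BY ENTRIES (⇐)**: a matrix of determinant `1` with `σ`-fixed diagonal and `σ`-skew off-diagonal entries is unitary for `antidiag(1,1)`.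
[cite: Rogawski1990, §1.9–§1.10 pp. 8–9] -/
theorem mem_unitaryGroupOfForm_antidiagTwo_of_det_eq_one_of_map_apply {g : GL (Fin 2) K} (hdet : (g : Matrix (Fin 2) (Fin 2) K).det = 1)
    (h00 : σ (g 0 0) = g 0 0) (h11 : σ (g 1 1) = g 1 1) (h01 : σ (g 0 1) = -(g 0 1 : K)) (h10 : σ (g 1 0) = -(g 1 0 : K)) :
    g ∈ unitaryGroupOfForm σ !![(0 : K), 1; 1, 0] := by
  rw [Matrix.det_fin_two] at hdet
  rw [mem_unitaryGroupOfForm_iff]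
  ext i j
  fin_cases i <;> fin_cases j <;>
    simp only [Matrix.mul_apply, Matrix.transpose_apply, Matrix.map_apply, Fin.sum_univ_two, Matrix.of_apply, Matrix.cons_val', Matrix.cons_val_zero,
      Matrix.cons_val_one, Matrix.empty_val', Matrix.cons_val_fin_one, Fin.isValue, Fin.mk_zero, Fin.mk_one, h00, h11, h01, h10] <;>
    [ring; linear_combination hdet; linear_combination hdet; ring]

end Special

/-! ## §4 The torus `t(e) = diag(e, (σe)⁻¹)` and the corner factorisation -/

section Torus

variable {K : Type*} [Field K] (σ : K →+* K)

/-- **`diag(e, (σe)⁻¹) ∈ U(σ, antidiag(1,1))`** for `σ` an involution and `e ≠ 0`; its determinant is `e ∕ σe`. [cite: Rogawski1990, §1.10 p. 9] -/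
theorem diag_mem_unitaryGroupOfForm_antidiagTwo (hσ : ∀ x, σ (σ x) = x) {t : GL (Fin 2) K} {e : K} (he : e ≠ 0)
    (ht : (t : Matrix (Fin 2) (Fin 2) K) = !![e, 0; 0, (σ e)⁻¹]) :
    t ∈ unitaryGroupOfForm σ !![(0 : K), 1; 1, 0] ∧ (t : Matrix (Fin 2) (Fin 2) K).det = e / σ e := by
  have hσe : σ e ≠ 0 := (map_ne_zero σ).2 he
  refine ⟨?_, by rw [ht, Matrix.det_fin_two_of, div_eq_mul_inv]; ring⟩
  rw [mem_unitaryGroupOfForm_iff, ht]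
  ext i j
  fin_cases i <;> fin_cases j <;> simp [Matrix.mul_apply, Fin.sum_univ_two, Matrix.transpose_apply, Matrix.map_apply, map_inv₀, hσ, he, hσe]

/-- **THE CORNER FACTORISATION `g = diag(a, (σa)⁻¹) · s`** for `g ∈ U(σ, antidiag(1,1))` with corner `a = g₀₀ ≠ 0` (`σ` an involution): `s := diag(a⁻¹, σa)·g` lies in `U`, has
`det s = 1` (§1: `det g = a∕σa`), and `s = !![1, g₀₁∕a; σa·g₁₀, σa·g₁₁]`. [cite: Rogawski1990, §1.10 p. 9] [cite: PlatonovRapinchuk1994, §2.3] -/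
theorem exists_diag_mul_of_apply_zero_zero_ne_zero (hσ : ∀ x, σ (σ x) = x) {g : GL (Fin 2) K} (hg : g ∈ unitaryGroupOfForm σ !![(0 : K), 1; 1, 0])
    (ha : (g 0 0 : K) ≠ 0) :
    ∃ t s : GL (Fin 2) K, (t : Matrix (Fin 2) (Fin 2) K) = !![(g 0 0 : K), 0; 0, (σ (g 0 0))⁻¹] ∧ t ∈ unitaryGroupOfForm σ !![(0 : K), 1; 1, 0] ∧
      s ∈ unitaryGroupOfForm σ !![(0 : K), 1; 1, 0] ∧ (s : Matrix (Fin 2) (Fin 2) K).det = 1 ∧ g = t * s ∧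
      (s : Matrix (Fin 2) (Fin 2) K) = !![(1 : K), (g 0 1 : K) * (g 0 0 : K)⁻¹; σ (g 0 0) * g 1 0, σ (g 0 0) * g 1 1] := by
  have hσa : σ (g 0 0) ≠ 0 := (map_ne_zero σ).2 ha
  have hdt : (!![(g 0 0 : K), 0; 0, (σ (g 0 0))⁻¹] : Matrix (Fin 2) (Fin 2) K).det ≠ 0 := by
    rw [Matrix.det_fin_two_of]; simp [ha, hσa]
  set t : GL (Fin 2) K := Matrix.GeneralLinearGroup.mkOfDetNeZero _ hdt with htdef
  have ht : (t : Matrix (Fin 2) (Fin 2) K) = !![(g 0 0 : K), 0; 0, (σ (g 0 0))⁻¹] := rfl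
  obtain ⟨htU, htdet⟩ := diag_mem_unitaryGroupOfForm_antidiagTwo σ hσ ha ht
  have htinv : ((t⁻¹ : GL (Fin 2) K) : Matrix (Fin 2) (Fin 2) K) = !![(g 0 0 : K)⁻¹, 0; 0, σ (g 0 0)] := by
    rw [Matrix.coe_units_inv, ht]
    refine Matrix.inv_eq_left_inv ?_
    ext i j
    fin_cases i <;> fin_cases j <;> simp [Matrix.mul_apply, Fin.sum_univ_two, ha, hσa]
  refine ⟨t, t⁻¹ * g, ht, htU, Subgroup.mul_mem _ (Subgroup.inv_mem _ htU) hg, ?_, by rw [mul_inv_cancel_left], ?_⟩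
  · rw [Units.val_mul, Matrix.det_mul, htinv, Matrix.det_fin_two_of, det_eq_apply_zero_zero_div σ hg ha]
    field_simp
    ring
  · rw [Units.val_mul, htinv]
    ext i j
    fin_cases i <;> fin_cases j <;> simp [Matrix.mul_apply, Fin.sum_univ_two, ha, mul_comm]

end Torus

/-! ## §5 Valued fields: the integral level is `T(𝒪)·SU(𝒪) ∪ Φ₂·T(𝒪)·SU(𝒪)` -/

section Valued

variable {K : Type*} [Field K] (σ : K →+* K) [Valued K ℤᵐ⁰] (hvσ : ∀ x, Valued.v (σ x) = Valued.v x)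

include hvσ in
/-- **`|det g| = 1`** for `g ∈ U(σ, antidiag(1,1))` (`det·σdet = 1` and `|σx| = |x|`). [cite: PlatonovRapinchuk1994, §3.3] -/
theorem valued_det_eq_one_of_mem_unitaryGroupOfForm_antidiagTwo {g : GL (Fin 2) K} (hg : g ∈ unitaryGroupOfForm σ !![(0 : K), 1; 1, 0]) :
    Valued.v (g : Matrix (Fin 2) (Fin 2) K).det = 1 := by
  have h := congrArg Valued.v (det_mul_map_det_eq_one σ hg)
  rw [map_mul, hvσ, map_one, ← pow_two] at h
  exact (pow_eq_one_iff_of_nonneg zero_le two_ne_zero).1 h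

include hvσ in
/-- **AN INTEGRAL UNITARY MATRIX HAS A UNIT IN ITS FIRST COLUMN**: if all `|gᵢⱼ| ≤ 1` then `|g₀₀| = 1` or `|g₁₀| = 1` (else `|det g| < 1`). [cite: PlatonovRapinchuk1994, §3.3] -/
theorem valued_apply_zero_zero_eq_one_or_of_integral {g : GL (Fin 2) K} (hg : g ∈ unitaryGroupOfForm σ !![(0 : K), 1; 1, 0])
    (hint : ∀ i j, Valued.v (g i j : K) ≤ 1) : Valued.v (g 0 0 : K) = 1 ∨ Valued.v (g 1 0 : K) = 1 := by
  by_contra h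
  rw [not_or] at h
  have h00 : Valued.v (g 0 0 : K) < 1 := lt_of_le_of_ne (hint 0 0) h.1
  have h10 : Valued.v (g 1 0 : K) < 1 := lt_of_le_of_ne (hint 1 0) h.2
  have hdet := valued_det_eq_one_of_mem_unitaryGroupOfForm_antidiagTwo σ hvσ hg
  rw [Matrix.det_fin_two] at hdet
  have hlt : Valued.v ((g 0 0 : K) * g 1 1 - g 0 1 * g 1 0) < 1 := by
    refine lt_of_le_of_lt (Valuation.map_sub _ _ _) (max_lt ?_ ?_)
    · rw [map_mul]; exact mul_lt_one_of_nonneg_of_lt_one_left zero_le h00 (hint 1 1)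
    · rw [map_mul]; exact mul_lt_one_of_nonneg_of_lt_one_right (hint 0 1) zero_le h10
  exact absurd hdet hlt.ne

include hvσ in
/-- **THE √u-CASE: `Φ₂ ∈ T(𝒪)·SU(𝒪)`.**  If `α` is an anti-fixed UNIT (`σα = −α`, `|α| = 1`; `σ` an involution) then `Φ₂ = diag(α, (σα)⁻¹) · s_α` with `s_α = !![0, α⁻¹; −α, 0] ∈ U`,
`det s_α = 1`, all entries of both factors of valuation `≤ 1`. [cite: Tits1979, §3.9] [cite: Jacobowitz1962, §5] -/
theorem exists_antidiagTwo_eq_diag_mul_of_antifixed_unit (hσ : ∀ x, σ (σ x) = x) {α : K} (hσα : σ α = -α) (hα : Valued.v α = 1) :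
    ∃ t s : GL (Fin 2) K, (t : Matrix (Fin 2) (Fin 2) K) = !![α, 0; 0, (σ α)⁻¹] ∧ t ∈ unitaryGroupOfForm σ !![(0 : K), 1; 1, 0] ∧
      s ∈ unitaryGroupOfForm σ !![(0 : K), 1; 1, 0] ∧ (s : Matrix (Fin 2) (Fin 2) K).det = 1 ∧
      (s : Matrix (Fin 2) (Fin 2) K) = !![(0 : K), α⁻¹; -α, 0] ∧ ((t * s : GL (Fin 2) K) : Matrix (Fin 2) (Fin 2) K) = !![(0 : K), 1; 1, 0] ∧
      (∀ i j, Valued.v ((t : Matrix (Fin 2) (Fin 2) K) i j) ≤ 1) ∧ (∀ i j, Valued.v ((s : Matrix (Fin 2) (Fin 2) K) i j) ≤ 1) := by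
  have hα0 : α ≠ 0 := fun h => by rw [h, map_zero] at hα; exact zero_ne_one hα
  have hσα0 : σ α ≠ 0 := (map_ne_zero σ).2 hα0
  have hdt : (!![α, 0; 0, (σ α)⁻¹] : Matrix (Fin 2) (Fin 2) K).det ≠ 0 := by rw [Matrix.det_fin_two_of]; simp [hα0, hσα0]
  have hds : (!![(0 : K), α⁻¹; -α, 0] : Matrix (Fin 2) (Fin 2) K).det = 1 := by
    rw [Matrix.det_fin_two_of, zero_mul, zero_sub, mul_neg, neg_neg, inv_mul_cancel₀ hα0]
  set t : GL (Fin 2) K := Matrix.GeneralLinearGroup.mkOfDetNeZero _ hdt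
  set s : GL (Fin 2) K := Matrix.GeneralLinearGroup.mkOfDetNeZero _ (by rw [hds]; exact one_ne_zero)
  have ht : (t : Matrix (Fin 2) (Fin 2) K) = !![α, 0; 0, (σ α)⁻¹] := rfl
  have hs : (s : Matrix (Fin 2) (Fin 2) K) = !![(0 : K), α⁻¹; -α, 0] := rfl
  obtain ⟨htU, -⟩ := diag_mem_unitaryGroupOfForm_antidiagTwo σ hσ hα0 ht
  have hsU : s ∈ unitaryGroupOfForm σ !![(0 : K), 1; 1, 0] :=
    mem_unitaryGroupOfForm_antidiagTwo_of_det_eq_one_of_map_apply σ (by rw [hs, hds]) (by simp [hs]) (by simp [hs])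
      (by simp [hs, map_inv₀, hσα, inv_neg]) (by simp [hs, hσα])
  have hvα' : Valued.v (σ α)⁻¹ = 1 := by rw [map_inv₀, hvσ, hα, inv_one]
  have hvαi : Valued.v α⁻¹ = 1 := by rw [map_inv₀, hα, inv_one]
  refine ⟨t, s, ht, htU, hsU, by rw [hs, hds], hs, ?_, ?_, ?_⟩
  · rw [Units.val_mul, ht, hs, hσα]
    ext i j
    fin_cases i <;> fin_cases j <;> simp [Matrix.mul_apply, Fin.sum_univ_two, hα0]
  · simp only [Fin.forall_fin_two, ht, Matrix.of_apply, Matrix.cons_val', Matrix.cons_val_zero, Matrix.cons_val_one, Matrix.empty_val', Matrix.cons_val_fin_one, map_zero,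
      zero_le, hα, hvα', le_refl, and_self]
  · simp only [Fin.forall_fin_two, hs, Matrix.of_apply, Matrix.cons_val', Matrix.cons_val_zero, Matrix.cons_val_one, Matrix.empty_val', Matrix.cons_val_fin_one, map_zero,
      zero_le, hvαi, Valuation.map_neg, hα, le_refl, and_self]

include hvσ in
/-- **THE INTEGRAL LEVEL OF `U(σ, antidiag(1,1))` IS `T(𝒪)·SU(𝒪) ∪ Φ₂·T(𝒪)·SU(𝒪)`** (`σ` an involution with `|σx| = |x|`).  An integral `g ∈ U` (all `|gᵢⱼ| ≤ 1`) is
`ε · t · s` with `ε ∈ {1, Φ₂}`, `t = diag(e, (σe)⁻¹)` for a UNIT `e`, and `s ∈ U` INTEGRAL with `det s = 1` (hence `SU` by entries, §3): `ε = 1` when `|g₀₀| = 1` (corner factorisation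
§4 at `e = g₀₀`), `ε = Φ₂` when `|g₀₀| < 1` (then `|g₁₀| = 1`, §5, and `Φ₂·g` has a unit corner). [cite: Tits1979, §3.9] [cite: PlatonovRapinchuk1994, §2.3, §3.3] -/
theorem exists_swap_mul_diag_mul_of_integral (hσ : ∀ x, σ (σ x) = x) {g : GL (Fin 2) K} (hg : g ∈ unitaryGroupOfForm σ !![(0 : K), 1; 1, 0])
    (hint : ∀ i j, Valued.v (g i j : K) ≤ 1) :
    ∃ (ε t s : GL (Fin 2) K) (e : K), ((ε : Matrix (Fin 2) (Fin 2) K) = 1 ∨ (ε : Matrix (Fin 2) (Fin 2) K) = !![(0 : K), 1; 1, 0]) ∧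
      Valued.v e = 1 ∧ (t : Matrix (Fin 2) (Fin 2) K) = !![e, 0; 0, (σ e)⁻¹] ∧ t ∈ unitaryGroupOfForm σ !![(0 : K), 1; 1, 0] ∧
      s ∈ unitaryGroupOfForm σ !![(0 : K), 1; 1, 0] ∧ (s : Matrix (Fin 2) (Fin 2) K).det = 1 ∧ (∀ i j, Valued.v ((s : Matrix (Fin 2) (Fin 2) K) i j) ≤ 1) ∧
      g = ε * t * s := by
  -- the unit-corner case, for any integral `h ∈ U` with `|h₀₀| = 1`
  have key : ∀ h : GL (Fin 2) K, h ∈ unitaryGroupOfForm σ !![(0 : K), 1; 1, 0] → (∀ i j, Valued.v (h i j : K) ≤ 1) → Valued.v (h 0 0 : K) = 1 →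
      ∃ (t s : GL (Fin 2) K) (e : K), Valued.v e = 1 ∧ (t : Matrix (Fin 2) (Fin 2) K) = !![e, 0; 0, (σ e)⁻¹] ∧ t ∈ unitaryGroupOfForm σ !![(0 : K), 1; 1, 0] ∧
        s ∈ unitaryGroupOfForm σ !![(0 : K), 1; 1, 0] ∧ (s : Matrix (Fin 2) (Fin 2) K).det = 1 ∧ (∀ i j, Valued.v ((s : Matrix (Fin 2) (Fin 2) K) i j) ≤ 1) ∧ h = t * s := by
    intro h hh hhint h1
    have ha : (h 0 0 : K) ≠ 0 := fun h0 => by rw [h0, map_zero] at h1; exact zero_ne_one h1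
    obtain ⟨t, s, ht, htU, hsU, hsdet, hts, hs⟩ := exists_diag_mul_of_apply_zero_zero_ne_zero σ hσ hh ha
    refine ⟨t, s, (h 0 0 : K), h1, ht, htU, hsU, hsdet, ?_, hts⟩
    have hσ1 : Valued.v (σ (h 0 0)) = 1 := by rw [hvσ, h1]
    intro i j
    fin_cases i <;> fin_cases j
    · simp [hs]
    · simp only [hs, Fin.zero_eta, Fin.isValue, Fin.mk_one, Matrix.of_apply, Matrix.cons_val', Matrix.cons_val_one, Matrix.cons_val_fin_one, Matrix.cons_val_zero,
        map_mul, map_inv₀, h1, inv_one, mul_one]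
      exact hhint 0 1
    · simp only [hs, Fin.mk_one, Fin.isValue, Fin.zero_eta, Matrix.of_apply, Matrix.cons_val', Matrix.cons_val_zero, Matrix.cons_val_one, Matrix.cons_val_fin_one,
        map_mul, hσ1, one_mul]
      exact hhint 1 0
    · simp only [hs, Fin.mk_one, Fin.isValue, Matrix.of_apply, Matrix.cons_val', Matrix.cons_val_one, Matrix.cons_val_fin_one, map_mul, hσ1, one_mul]
      exact hhint 1 1
  rcases valued_apply_zero_zero_eq_one_or_of_integral σ hvσ hg hint with h1 | h1
  · obtain ⟨t, s, e, he, ht, htU, hsU, hsdet, hsint, hts⟩ := key g hg hint h1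
    exact ⟨1, t, s, e, Or.inl (by rw [Units.val_one]), he, ht, htU, hsU, hsdet, hsint, by rw [one_mul]; exact hts⟩
  · -- swap the rows: `Φ₂ · g` has a unit corner
    obtain ⟨w₀, hw₀⟩ : ∃ w₀ : GL (Fin 2) K, (w₀ : Matrix (Fin 2) (Fin 2) K) = !![(0 : K), 1; 1, 0] :=
      ⟨Matrix.GeneralLinearGroup.mkOfDetNeZero !![(0 : K), 1; 1, 0] (by rw [Matrix.det_fin_two_of]; norm_num), rfl⟩
    obtain ⟨hw₀U, -⟩ := mem_unitaryGroupOfForm_antidiagTwo_of_coe_eq σ hw₀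
    have hcoe : ((w₀ * g : GL (Fin 2) K) : Matrix (Fin 2) (Fin 2) K) = !![(0 : K), 1; 1, 0] * (g : Matrix (Fin 2) (Fin 2) K) := by rw [Units.val_mul, hw₀]
    obtain ⟨e00, e10, e01, e11⟩ := antidiagTwo_mul_apply (g : Matrix (Fin 2) (Fin 2) K)
    have hint' : ∀ i j, Valued.v ((w₀ * g : GL (Fin 2) K) i j : K) ≤ 1 := by
      have hc : ∀ i j, ((w₀ * g : GL (Fin 2) K) i j : K) = (!![(0 : K), 1; 1, 0] * (g : Matrix (Fin 2) (Fin 2) K)) i j := fun i j => by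
        rw [hcoe]
      simp only [Fin.forall_fin_two, hc, e00, e10, e01, e11]
      exact ⟨⟨hint 1 0, hint 1 1⟩, hint 0 0, hint 0 1⟩
    have h1' : Valued.v ((w₀ * g : GL (Fin 2) K) 0 0 : K) = 1 := by
      have hc : ((w₀ * g : GL (Fin 2) K) 0 0 : K) = (!![(0 : K), 1; 1, 0] * (g : Matrix (Fin 2) (Fin 2) K)) 0 0 := by
        rw [hcoe]
      rw [hc, e00]; exact h1
    obtain ⟨t, s, e, he, ht, htU, hsU, hsdet, hsint, hts⟩ := key (w₀ * g) (Subgroup.mul_mem _ hw₀U hg) hint' h1'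
    have hw₀2 : w₀ * w₀ = 1 := by
      apply Units.ext
      rw [Units.val_mul, hw₀, Units.val_one]
      ext i j; fin_cases i <;> fin_cases j <;> simp [Matrix.mul_apply, Fin.sum_univ_two]
    refine ⟨w₀, t, s, e, Or.inr hw₀, he, ht, htU, hsU, hsdet, hsint, ?_⟩
    calc g = w₀ * (w₀ * g) := by rw [← mul_assoc, hw₀2, one_mul]
      _ = w₀ * t * s := by rw [hts, mul_assoc]

end Valued

end UnitaryGroup

end Literature.NumberTheory.Automorphic
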